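import Literature.MathematicalPhysics.QuantumLattice.HubbardTTPrimeThermalPressureParticleHole
import Literature.MathematicalPhysics.QuantumLattice.HubbardTTPrimeApexRowThermal
import Literature.MathematicalPhysics.QuantumLattice.HubbardTTPrimeApexRowGroundToThermal
import Literature.MathematicalPhysics.QuantumLattice.HubbardTTPrimeMeanEnergySupergradient
import HarnessLib

/-!
# The THERMAL half-filling hinge: `t'·K₂(ω) ≤ 0` for every torus limit `ω` of the canonical sector Gibbs states of
# the `t–t'` Hubbard model at half filling — and the thermal apex rows it unlocks (own-word thermal sources,
# corner-objective sources read to the right of the corner)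

Family `hubbard` (topic `MathematicalPhysics/QuantumLattice`); seat `hubbard-downfold-unc-2` (`prover-hubbard-downfold-unc-2-g18-0`), the
`T > 0` leg of the Hubbard material-oracle programme. Closes the gap recorded in `HubbardTTPrimeApexRowThermal` and
`StiffnessApexTransportThermal` («the half-filling sign of `K₂` for thermal states is not used or proved here»).

THE OBSERVATION. `K₂(ω) = e_{Φ(0,1,0)}(ω)` is the unit-diagonal-hopping energy per site. Finite volume: the Peierls–Bogoliubov
tangent of the convex `s ↦ log Z_β(H_L(t,s,U)|_sec)` at `s = t'`, evaluated at `s = −t'`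
(`log_partitionFn_sector_sub_mem_Icc_tPrime`, any sector, any `L`):
  `log Z_L(t') − log Z_L(−t') ≤ −2βt'·Σ_i p_{L,i} Re⟨ψ_{L,i}, H_L(0,1,0) ψ_{L,i}⟩`.
Divide by `L²` and let `L → ∞` along the tori of `ω`: the left side tends to `p(β;t,t',U;1) − p(β;t,−t',U;1) = 0` — the
thermodynamic-limit sector pressure is EVEN in `t'` at half filling (`pressureTT'_halfFilling_neg_tPrime`, the `T > 0` twin of
`energyDensityTT'_particleHole_one`; proved through the particle–hole map on EVEN tori, but the limit exists along ALL tori, so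
no parity of `ω`'s tori is needed) — and the right side to `−2βt'K₂(ω)`. Hence `βt'K₂(ω) ≤ 0`, i.e. for `β > 0`:

  `t'·K₂(ω) ≤ 0` for every thermal torus limit at `(β; t, t', U, n = 1)`, either sign of `t'` (§1).

Consequences (§2–§3, mirrors of `HubbardTTPrimeApexRow` §4 and of the `T = 0`/`T > 0` apex rows):
* the thermal one-body energy is monotone in the hopping in the direction of `t'`: `κ' − κ = c·t'`, `c ≥ 0` ⇒
  `e_{Φ(t,κ',0)}(ω) ≤ e_{Φ(t,κ,0)}(ω)`;
* THERMAL SOURCE, own word (`HubbardTTPrimeApexRowThermal` + hinge at the source): on the ray `β_A U_A = β_P U_P`,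
  `β_A t'_A = (2β_A − β_P) t'_P`: a thermal floor `ℓ ≤ e_{Φ(t,2t'_A,0)}` at `A` (the source's OWN f-sum word) is a floor
  `ℓ ≤ e_{Φ(t,2t'_P,0)}` at `P`;
* GROUND-STATE SOURCE, CORNER objective read to the RIGHT of the corner (`HubbardTTPrimeApexRowGroundToThermal` + hinge at the
  thermal TARGET): `κ(A,P) = 2σ` and `2σ − 2t'_P = c·t'_P`, `c ≥ 0` (i.e. `σ ≤ t'_P ≤ 0` or `0 ≤ t'_P ≤ σ`): a `T = 0` floor
  `ℓ ≤ e_{Φ(t,2σ,0)}` on the ground-state class at `A` gives `ℓ − U_A·(2H_b(1/2)/β)/(U_P − U_A) ≤ e_{Φ(t,2t'_P,0)}(ω_P)` — the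
  «transport shadow» of a corner-objective row is a thermal word, not only the corner's own edge.

Everything is PROVED; no definition, no named fact, no number. HONEST SCOPE: half filling only; `β > 0`; transport of one-sided
bounds; no certificate, no phase sentence.

## Mathlib / tree search
REUSED: `log_partitionFn_sector_sub_mem_Icc_tPrime` (`HubbardTTPrimeDiagHopTransportThermal`), `tendsto_log_partitionFn_div_sq_comp`,
`pressureTT'_halfFilling_neg_tPrime` (`HubbardTTPrimeThermalPressure{Limit,ParticleHole}`), `IsTorusLimitOfMixture.tendsto_meanEnergy_hubbardTTPrime`,
`meanEnergy_hubbardTTPrime_affine`, the thermal apex row `…le_meanEnergy_twice_tPrime_of_forall_source_thermal` and the ground → thermal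
row `…le_meanEnergy_apexHopping_thermal_of_forall_groundSource`. `lean search 'halfFilling.*sectorGibbs|thermal.*hinge|diagHop.*nonpos.*Gibbs'`: only
the `T = 0` hinge `IsTorusLimitOf.tPrime_mul_diagHopEnergy_nonpos_of_groundState_halfFilling`.

## References
* E. H. Lieb, Commun. Math. Phys. 31 (1973) 327, §V (5.2)–(5.4) (Peierls–Bogoliubov). [cite: Lieb1973, §V (5.2)–(5.4)]
* E. H. Lieb, F. Y. Wu, Physica A 321 (2003) 1, §1 eq. (3) (particle–hole symmetry at half filling). [cite: LiebWuPhysicaA2003, §1 eq. (3)]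
* T. Koma, H. Tasaki, J. Stat. Phys. 76 (1994) 745, §1. [cite: KomaTasaki1994, §1]
* D. Ruelle, *Statistical Mechanics* (1969), §2.5. [cite: Ruelle1969, §2.5]
-/

noncomputable section

namespace Literature.MathematicalPhysics.QuantumLattice

open Matrix Finset HubbardWave0 Literature.Probability.LatticeModels ThermodynamicLimit
open _root_.Filter
open scoped _root_.Topology ComplexOrder BigOperators

namespace InfVolFermionState

variable {t : ℝ}

/-! ### §1 The thermal hinge -/

/-- **THE THERMAL HALF-FILLING HINGE.** `0 < β`, `0 ≤ U`; `ω` a torus limit of the canonical `(rectN 1 L, S^z = 0)`-sector Gibbs states of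
`hubbardTorusTT' L t t' U` at inverse temperature `β` (along ANY `Ls → ∞`). Then `t'·K₂(ω) ≤ 0`, `K₂(ω) = e_{Φ(0,1,0)}(ω)`: the
Peierls–Bogoliubov tangent `log Z_L(t') − log Z_L(−t') ≤ −2βt'·⟨K₂⟩_{L,t'}` divided by `L²`, in the limit, against the evenness
`p(β;t,t',U;1) = p(β;t,−t',U;1)` of the sector pressure. [cite: Lieb1973, §V (5.2)–(5.4)] [cite: LiebWuPhysicaA2003, §1 eq. (3)] -/
theorem IsTorusLimitOfMixture.tPrime_mul_diagHopEnergy_nonpos_of_sectorGibbs_halfFilling {β : ℝ} (hβ : 0 < β) (t t' : ℝ)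
    {U : ℝ} (hU : 0 ≤ U) {ω : InfVolFermionState 2} {Ls : ℕ → ℕ}
    (hω : ω.IsTorusLimitOfMixture (sectorGibbsCount 1) (fun L => sectorGibbsWeightTT' β t t' U 1 L)
      (fun L => sectorGibbsVectorTT' t t' U 1 L) Ls)
    (hLs : Tendsto Ls atTop atTop) :
    t' * ω.meanEnergy (hubbardTTPrimeFermionInteraction 0 1 0) 1 ≤ 0 := by
  -- the three limits along `Ls`
  have hp₁ := tendsto_log_partitionFn_div_sq_comp hβ.le t t' hU zero_le_one one_lt_two hLs
  have hp₂ := tendsto_log_partitionFn_div_sq_comp hβ.le t (-t') hU zero_le_one one_lt_two hLs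
  have hK := hω.tendsto_meanEnergy_hubbardTTPrime 0 1 0 hLs
  -- the finite-volume Peierls–Bogoliubov tangent, per volume
  have hev : ∀ᶠ j in atTop,
      Real.log (partitionFn β (sectorHamiltonianTT' t t' U 1 (Ls j))).re / (Ls j : ℝ) ^ 2 -
          Real.log (partitionFn β (sectorHamiltonianTT' t (-t') U 1 (Ls j))).re / (Ls j : ℝ) ^ 2 ≤
        -(2 * β * t') * ∑ i, sectorGibbsWeightTT' β t t' U 1 (Ls j) i *
          ((QuantumLattice.expect (hubbardTorusTT' (Ls j) 0 1 0) (sectorGibbsVectorTT' t t' U 1 (Ls j) i)).re /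
            (Ls j : ℝ) ^ 2) := by
    filter_upwards [hLs.eventually_ge_atTop 1] with j hj
    haveI : NeZero (Ls j) := ⟨by omega⟩
    have hL2 : (0 : ℝ) < (Ls j : ℝ) ^ 2 := by positivity
    have hb := (log_partitionFn_sector_sub_mem_Icc_tPrime zero_le_one one_le_two (Ls j) t U β t' (-t')).2
    have hsum : ∑ i, sectorGibbsWeightTT' β t t' U 1 (Ls j) i *
        ((QuantumLattice.expect (hubbardTorusTT' (Ls j) 0 1 0) (sectorGibbsVectorTT' t t' U 1 (Ls j) i)).re /
          (Ls j : ℝ) ^ 2) =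
        (∑ i, sectorGibbsWeightTT' β t t' U 1 (Ls j) i *
          (QuantumLattice.expect (hubbardTorusTT' (Ls j) 0 1 0) (sectorGibbsVectorTT' t t' U 1 (Ls j) i)).re) /
          (Ls j : ℝ) ^ 2 := by
      rw [Finset.sum_div]
      exact Finset.sum_congr rfl fun i _ => by ring
    rw [hsum, ← sub_div, div_le_iff₀ hL2, mul_div_assoc', div_mul_cancel₀ _ hL2.ne']
    nlinarith [hb]
  have hlim := le_of_tendsto_of_tendsto (hp₁.sub hp₂) (hK.const_mul (-(2 * β * t'))) hev
  rw [pressureTT'_halfFilling_neg_tPrime hβ.le t t' hU, sub_self] at hlim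
  nlinarith [hlim]

/-- **At half filling the THERMAL one-body energy is monotone in the hopping in the direction of `t'`.** Same class as the hinge; for two
hoppings with `κ' − κ = c·t'`, `c ≥ 0`: `e_{Φ(t,κ',0)}(ω) ≤ e_{Φ(t,κ,0)}(ω)` (the difference is `c·t'·K₂(ω) ≤ 0`). The `T > 0` twin of
`IsTorusLimitOf.meanEnergy_oneBody_anti_hopping_of_groundState_halfFilling`. [cite: KomaTasaki1994, §1] [cite: LiebWuPhysicaA2003, §1 eq. (3)] -/
theorem IsTorusLimitOfMixture.meanEnergy_oneBody_anti_hopping_of_sectorGibbs_halfFilling {β : ℝ} (hβ : 0 < β) (t t' : ℝ)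
    {U : ℝ} (hU : 0 ≤ U) {ω : InfVolFermionState 2} {Ls : ℕ → ℕ}
    (hω : ω.IsTorusLimitOfMixture (sectorGibbsCount 1) (fun L => sectorGibbsWeightTT' β t t' U 1 L)
      (fun L => sectorGibbsVectorTT' t t' U 1 L) Ls)
    (hLs : Tendsto Ls atTop atTop) {κ κ' c : ℝ} (hc : 0 ≤ c) (hκ : κ' - κ = c * t') :
    ω.meanEnergy (hubbardTTPrimeFermionInteraction t κ' 0) 1 ≤ ω.meanEnergy (hubbardTTPrimeFermionInteraction t κ 0) 1 := by
  have hs := IsTorusLimitOfMixture.tPrime_mul_diagHopEnergy_nonpos_of_sectorGibbs_halfFilling hβ t t' hU hω hLs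
  rw [ω.meanEnergy_hubbardTTPrime_affine t κ 0 κ' 0, sub_self, zero_mul, add_zero, hκ]
  nlinarith [mul_nonpos_iff.2 (Or.inl ⟨hc, hs⟩)]

/-! ### §2 Thermal source, own word: the thermal apex row with the hinge at the source -/

/-- **THERMAL SOURCE'S OWN f-sum word ⇒ the target's, on the ray `βU = const` (half filling).** `0 < β_P < β_A`, `β_A U_A = β_P U_P`,
`0 ≤ U_A`, `β_A t'_A = (2β_A − β_P) t'_P` (the source on the target's thermal apex segment). If `ℓ ≤ e_{Φ(t,2t'_A,0)}(ω_A)` for EVERY torus limit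
`ω_A` of the canonical sector Gibbs states at `(β_A; t, t'_A, U_A, 1)` — the source class's OWN f-sum word — then `ℓ ≤ e_{Φ(t,2t'_P,0)}(ω_P)` for
every torus limit `ω_P` of the canonical sector Gibbs states at `(β_P; t, t'_P, U_P, 1)`: the hinge at the (thermal) SOURCE turns the own word into a
word for the target's objective (`2t'_A − 2t'_P = c·t'_A`, `c = 2(β_A − β_P)/(2β_A − β_P) ≥ 0`), then the thermal apex row moves it.
[cite: Lieb1973, §V (5.2)–(5.4)] [cite: KomaTasaki1994, §1] -/
theorem IsTorusLimitOfMixture.le_meanEnergy_twice_tPrime_of_forall_source_ownWord_thermal_halfFilling {βA βP UA UP : ℝ}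
    (hβP : 0 < βP) (hβ : βP < βA) (hγ : βA * UA = βP * UP) (hUA : 0 ≤ UA) {t'A t'P : ℝ}
    (hapex : βA * t'A = (2 * βA - βP) * t'P) {ℓ : ℝ}
    (hℓ : ∀ (ωA : InfVolFermionState 2) (LsA : ℕ → ℕ), Tendsto LsA atTop atTop →
      ωA.IsTorusLimitOfMixture (sectorGibbsCount 1) (fun L => sectorGibbsWeightTT' βA t t'A UA 1 L)
        (fun L => sectorGibbsVectorTT' t t'A UA 1 L) LsA →
      ℓ ≤ ωA.meanEnergy (hubbardTTPrimeFermionInteraction t (2 * t'A) 0) 1)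
    {ωP : InfVolFermionState 2} {Ls : ℕ → ℕ}
    (hP : ωP.IsTorusLimitOfMixture (sectorGibbsCount 1) (fun L => sectorGibbsWeightTT' βP t t'P UP 1 L)
      (fun L => sectorGibbsVectorTT' t t'P UP 1 L) Ls)
    (hLs : Tendsto Ls atTop atTop) :
    ℓ ≤ ωP.meanEnergy (hubbardTTPrimeFermionInteraction t (2 * t'P) 0) 1 := by
  have hβA : 0 < βA := hβP.trans hβ
  have h2 : 0 < 2 * βA - βP := by linarith
  have hc : 0 ≤ 2 * (βA - βP) / (2 * βA - βP) := div_nonneg (by linarith) h2.le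
  have hκ : 2 * t'A - 2 * t'P = 2 * (βA - βP) / (2 * βA - βP) * t'A := by
    have ht'P : t'P = βA * t'A / (2 * βA - βP) := by rw [eq_div_iff h2.ne', hapex]; ring
    rw [ht'P]
    field_simp
    ring
  refine IsTorusLimitOfMixture.le_meanEnergy_twice_tPrime_of_forall_source_thermal (t := t) zero_le_one one_le_two hβ hγ
    hapex (ℓ := ℓ) (fun ωA LsA hLsA hωA => ?_) hP hLs
  exact (hℓ ωA LsA hLsA hωA).trans
    (IsTorusLimitOfMixture.meanEnergy_oneBody_anti_hopping_of_sectorGibbs_halfFilling hβA t t'A hUA hωA hLsA hc hκ)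

/-! ### §3 Ground-state source, CORNER objective read to the right of the corner: the hinge at the thermal target -/

/-- **GROUND-STATE SOURCE, CORNER OBJECTIVE, THERMAL TARGET RIGHT OF THE CORNER (half filling).** `0 ≤ U_A < U_P`, `0 < β`; the line `AP` meets
`U = 0` at the doubled corner hopping, `U_P t'_A − U_A t'_P = 2σ(U_P − U_A)`; the target lies between the corner and `t' = 0` on the corner's side,
`2σ − 2t'_P = c·t'_P` with `c ≥ 0`. If `ℓ ≤ e_{Φ(t,2σ,0)}(ω_A)` for EVERY torus limit of unit sector GROUND states at `(t, t'_A, U_A, 1)` (a `T = 0`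
certificate of the corner objective `−X₀(σ)` at the source), then for every torus limit `ω_P` of the canonical sector Gibbs states at
`(β; t, t'_P, U_P, 1)`: `ℓ − U_A·(2H_b(1/2)/β)/(U_P − U_A) ≤ e_{Φ(t,2t'_P,0)}(ω_P)` — the ground → thermal apex row moves the floor on `e_{Φ(t,2σ,0)}` to
the thermal target, where the hinge turns it into a floor on the target's own f-sum objective. [cite: Ruelle1969, §2.5] [cite: KomaTasaki1994, §1] -/
theorem IsTorusLimitOfMixture.le_meanEnergy_twice_tPrime_thermal_of_forall_groundSource_cornerObjective_halfFilling
    (t t'A t'P σ : ℝ) {UA UP : ℝ} (hUA : 0 ≤ UA) (hU : UA < UP) {β : ℝ} (hβ : 0 < β)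
    (hκ : UP * t'A - UA * t'P = 2 * σ * (UP - UA)) {c : ℝ} (hc : 0 ≤ c) (hσ : 2 * σ - 2 * t'P = c * t'P) {ℓ : ℝ}
    (hℓ : ∀ (ωA : InfVolFermionState 2) (LsA : ℕ → ℕ) (ψA : ∀ L, Fock (Orb (FermionTorus 2 L))),
      Tendsto LsA atTop atTop →
      (∀ j, IsGroundStateInSector (hubbardTorusTT' (LsA j) t t'A UA) (rectN 1 (LsA j)) 0 (ψA (LsA j))) →
      (∀ j, star (ψA (LsA j)) ⬝ᵥ ψA (LsA j) = 1) → ωA.IsTorusLimitOf ψA LsA →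
      ℓ ≤ ωA.meanEnergy (hubbardTTPrimeFermionInteraction t (2 * σ) 0) 1)
    {ωP : InfVolFermionState 2} {LsP : ℕ → ℕ}
    (hP : ωP.IsTorusLimitOfMixture (sectorGibbsCount 1) (fun L => sectorGibbsWeightTT' β t t'P UP 1 L)
      (fun L => sectorGibbsVectorTT' t t'P UP 1 L) LsP)
    (hLsP : Tendsto LsP atTop atTop) :
    ℓ - UA * (2 * Real.binEntropy (1 / 2) / β) / (UP - UA) ≤
      ωP.meanEnergy (hubbardTTPrimeFermionInteraction t (2 * t'P) 0) 1 := by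
  have hd : UP - UA ≠ 0 := (sub_pos.2 hU).ne'
  have hap : (UP * t'A - UA * t'P) / (UP - UA) = 2 * σ := by
    rw [div_eq_iff hd, hκ]
  have hUP : 0 ≤ UP := hUA.trans hU.le
  have h := IsTorusLimitOfMixture.le_meanEnergy_apexHopping_thermal_of_forall_groundSource t t'A t'P hUA hU zero_le_one
    one_lt_two hβ (ℓ := ℓ) (by rw [hap]; exact hℓ) hP hLsP
  rw [hap] at h
  exact h.trans (IsTorusLimitOfMixture.meanEnergy_oneBody_anti_hopping_of_sectorGibbs_halfFilling hβ t t'P hUP hP hLsP hc hσ)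

end InfVolFermionState

end Literature.MathematicalPhysics.QuantumLattice

end
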